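import Summits.ResolutionOfSingularities.ResolutionOfSingularities.Theorems.EquisingularLiftEquisingularLiftNatTransversalTraceLocal
import Summits.ResolutionOfSingularities.ResolutionOfSingularities.Theorems.EquisingularLiftEquisingularLiftNatTransversalTraceDownstairs
import Summits.ResolutionOfSingularities.ResolutionOfSingularities.Theorems.EquisingularLiftEquisingularLiftNatTowerExceptionalDense
import Literature.AlgebraicGeometry.Resolution.EtaleVanishingIdeal
import Literature.AlgebraicGeometry.Resolution.MonomialMarkedIdealsBlowup
import Literature.AlgebraicGeometry.Resolution.MonomialOrderReductionUnit
import HarnessLib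

/-!
# [OURS · L1 W4.5(b) · EL♮(3) · T23-A′ (A′-3)] THE TRACE OF THE STRICT TRANSFORM OF A TRANSVERSAL MEMBER:
# `(St_C 𝓕 · 𝒪_{X₂})·𝒪_{G'} = 𝓘⟨closure υ₂⁻¹(F ∖ Z)⟩` — the special fibre of `St_C V(𝓕)` is the downstairs strict transform of `F`, REDUCED

Crux EL♮(3) = stmt-ResolutionOfSingularities-20148 (child of EL♮ stmt-…-20038; bookkeeping crux `EquisingularLift` stmt-…-15660); T23-A′ =
the transversal round-transport widening of `TowerRoundB` (res-L1-w45b-stub-4 g10, engine word 340f00d84dbcbbfc); brick **(A′-3)** BY stub-4's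
SIG v2 `L/res-L1-w45b-stub-4/T23Aprime-TransversalTransport.sig.v2.lean` 767f3543c2b2e4ae (`comap_strictTransformIdeal_eq_vanishingIdeal_of_transversal`,
hypotheses (T1)/(T2)), dealt to res-L1-w45b-stub-2 g12 by res-L1-w45b-plan-1's R12′ (iii). OURS; NOT a statement of H. Hironaka's 2017
manuscript; AI-written, weaker than expert review. No `sorry`; standard axioms; DEF-FREE. `--supports stmt-ResolutionOfSingularities-20148 --as helper`.

STATEMENT (= SIG v2 verbatim up to `_`-prefixes on the binders the proof does not consume: `_hXreg`, `_hCreg`, `_hF2`, `_hFflat` and the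
instances `[IsIntegral X]`, `[IsProper (σ ≫ q)]`, `[IsLocallyNoetherian G]`). Model squares `jG : G → X`, `j₂ : G' → X₂` over `Spec θ`
(`θ : O ↠ k`, `O` a DVR), `τ : X₂ → X` the blow-up of the centre `C` (REDUCED trace `C·𝒪_G = 𝓘⟨Z⟩`, `V(C)` flat over `O`), `υ₂ : G' → G`
the blow-up of `𝓘⟨Z⟩` with `j₂ ≫ τ = υ₂ ≫ jG`, the member `𝓕` with reduced trace `𝓕·𝒪_G = 𝓘⟨F⟩` and `HasSNCWith [𝓕] C`, and at every
crossing point `g ∈ Z ∩ F`: (T1) `𝓘⟨Z⟩_g + 𝓘⟨F⟩_g = 𝔪_{G,g}` and (T2) `𝓘⟨Z⟩_g ≠ 𝔪_{G,g}`. CONCLUSION: `(St_C 𝓕).comap j₂ = 𝓘⟨closure υ₂⁻¹(F ∖ Z)⟩`.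

PROOF. `L := (St_C 𝓕).comap j₂`; we show `L` is RADICAL (`radical_eq_iff_forall_stalkIdeal`) with SUPPORT `closure υ₂⁻¹(F ∖ Z)`, whence
`L = 𝓘⟨supp L⟩` (Mathlib `vanishingIdeal_support`). At `y ∈ G'` over `g = υ₂ y`:
* `g ∉ Z`: `τ` is a local isomorphism, `L_y = υ₂♯(𝓘⟨F⟩_g)` (`stalkIdeal_strictTransformIdeal_of_not_mem_support`), radical, and `y ∈ supp L ↔ g ∈ F`;
* `g ∈ Z ∖ F`: `L_y = ⊤`;
* `g ∈ Z ∩ F` (the crossing): the local half …NatTransversalTraceLocal `exists_rsop_transversal_crossing` — fed with (T1)/(T2) pulled back along the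
  surjection `jG♯_g` (kernel `(ϖ)`), the reducedness of `C_x + (ϖ)` (trace `𝓘⟨Z⟩`) and the `O`-flatness of `V(C)` (so `ϖ` is `C_x`-regular) — puts
  `(wE, f', ϖ)` (exceptional generator, generator of `(St𝓕)_{x₂}`, uniformiser) in a regular system of parameters of `𝒪_{X₂,x₂}`; since
  `𝒪_{G',y} = 𝒪_{X₂,x₂}/(ϖ)` (model square), `𝒪_{G',y}/L_y ≅ 𝒪_{X₂,x₂}/(f', ϖ)` is regular, so `L_y` is PRIME; and the point `η` of `X₂` given by the
  prime `(f', ϖ)` generises `x₂`, lies in `V(St𝓕)` and over the closed point of `O` — so `η = j₂ η'` — but NOT on the exceptional divisor (`wE ∉ (f', ϖ)`),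
  hence `η' ∈ υ₂⁻¹(F ∖ Z)` and `y ∈ closure {η'}`: no component of the trace hides in the exceptional locus.
References (index only): …NatTransversalTraceLocal (local half), …NatExceptionalReducedModel / …NatCarrierDeltaComapFrame (`stalkMap_model_*`,
`ker_stalkMap_model_le`), …NatTowerExceptionalDense (generic-point pattern), Literature `BlowupSNC`, `StalkIdealLemmas`, `EtaleVanishingIdeal`.
[cite: Matsumura1987, Thm. 14.2] [cite: Liu2002, Thm. 8.1.19] [cite: Kollar2007, Def. 3.25]
-/

set_option linter.dupNamespace false
set_option linter.overlappingInstances false -- the binders carry `[IsDomain O] [IsDiscreteValuationRing O]`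

noncomputable section

open CategoryTheory CategoryTheory.Limits AlgebraicGeometry TopologicalSpace Topology IsLocalRing
open Literature.AlgebraicGeometry.Resolution
open AlgebraicGeometry.Scheme.IdealSheafData
open Summit.ResolutionOfSingularities.ResolutionOfSingularities.Cruxes.EquisingularLift.StrataSplit (stalkMap_Γgerm_apply')

namespace Summit.ResolutionOfSingularities.ResolutionOfSingularities.Cruxes.EquisingularLiftNat.Sections

/-! ## The trace theorem -/

section Trace

variable {O : Type} [CommRing O] [IsDomain O] [IsDiscreteValuationRing O] {k : Type} [Field k] {θ : O →+* k}
  {P : Scheme.{0}} {q : P ⟶ Spec (.of O)}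
  {G G' X X₂ : Scheme.{0}} {σ : X ⟶ P} {jG : G ⟶ X} {tG : G ⟶ Spec (.of k)}
  {C 𝓕 : X.IdealSheafData} {τ : X₂ ⟶ X} {υ₂ : G' ⟶ G} {j₂ : G' ⟶ X₂} {t₂ : G' ⟶ Spec (.of k)}
  {Z F : Set G} {hZ : IsClosed Z} {hF : IsClosed F}

/-- **(A′-3) The crossing-point package**: at `y ∈ G'` over `g ∈ Z ∩ F`, the stalk of `L = (St_C 𝓕)·𝒪_{G'}` is PRIME (so radical), `y ∈ supp L`,
and `y ∈ closure υ₂⁻¹(F ∖ Z)`. [cite: Matsumura1987, Thm. 14.2] [cite: Liu2002, Thm. 8.1.19] [OURS · L1 W4.5b · T23-A′ (A′-3)] -/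
theorem transversal_crossing_package [IsLocallyNoetherian X] [IsLocallyNoetherian X₂]
    (hsq : IsPullback jG tG (σ ≫ q) (Spec.map (CommRingCat.ofHom θ))) (hθ : Function.Surjective θ)
    (hτ : IsBlowup τ C) (hcomm : j₂ ≫ τ = υ₂ ≫ jG) (hsq₂ : IsPullback j₂ t₂ ((τ ≫ σ) ≫ q) (Spec.map (CommRingCat.ofHom θ)))
    (hC : C.comap jG = vanishingIdeal ⟨Z, hZ⟩) (hCflat : Flat (C.subschemeι ≫ σ ≫ q)) (hE : HasSNCWith [𝓕] C)
    (hF1 : 𝓕.comap jG = vanishingIdeal ⟨F, hF⟩)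
    (hT1 : ∀ g ∈ Z ∩ F, stalkIdeal (vanishingIdeal (⟨Z, hZ⟩ : Closeds G)) g ⊔ stalkIdeal (vanishingIdeal (⟨F, hF⟩ : Closeds G)) g =
      maximalIdeal (G.presheaf.stalk g))
    (hT2 : ∀ g ∈ Z ∩ F, stalkIdeal (vanishingIdeal (⟨Z, hZ⟩ : Closeds G)) g ≠ maximalIdeal (G.presheaf.stalk g))
    (hmem_off : ∀ y : G', υ₂ y ∉ Z → (y ∈ ((strictTransformIdeal τ C 𝓕).comap j₂).support ↔ υ₂ y ∈ F))
    (y : G') (hy : υ₂ y ∈ Z ∩ F) :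
    (stalkIdeal ((strictTransformIdeal τ C 𝓕).comap j₂) y).IsPrime ∧ y ∈ ((strictTransformIdeal τ C 𝓕).comap j₂).support ∧
      y ∈ closure (υ₂ ⁻¹' (F \ Z)) := by
  classical
  obtain ⟨ϖ, hϖ⟩ := IsDiscreteValuationRing.exists_irreducible O
  haveI : IsClosedImmersion (Spec.map (CommRingCat.ofHom θ)) := IsClosedImmersion.spec_of_surjective _ hθ
  haveI : IsClosedImmersion jG := MorphismProperty.IsStableUnderBaseChange.of_isPullback hsq.flip inferInstance
  haveI : IsClosedImmersion j₂ := MorphismProperty.IsStableUnderBaseChange.of_isPullback hsq₂.flip inferInstance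
  have hpt : τ (j₂ y) = jG (υ₂ y) := by rw [← Scheme.Hom.comp_apply, hcomm, Scheme.Hom.comp_apply]
  have hZsupp : ∀ g : G, g ∈ Z ↔ jG g ∈ C.support := fun g => by
    have h : g ∈ ((C.comap jG).support : Set G) ↔ jG g ∈ C.support := by
      rw [Scheme.IdealSheafData.support_comap]; rfl
    rw [← h, hC, Scheme.IdealSheafData.coe_support_vanishingIdeal]; rfl
  have hFsupp : ∀ g : G, g ∈ F ↔ jG g ∈ 𝓕.support := fun g => by
    have h : g ∈ ((𝓕.comap jG).support : Set G) ↔ jG g ∈ 𝓕.support := by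
      rw [Scheme.IdealSheafData.support_comap]; rfl
    rw [← h, hF1, Scheme.IdealSheafData.coe_support_vanishingIdeal]; rfl
  have hxC : τ (j₂ y) ∈ C.support := by rw [hpt]; exact (hZsupp _).mp hy.1
  have hxF : τ (j₂ y) ∈ 𝓕.support := by rw [hpt]; exact (hFsupp _).mp hy.2
  -- the downstairs package, transported from `jG (υ₂ y)` to `τ (j₂ y)`
  have hdown : (stalkIdeal C (τ (j₂ y)) ⊔ stalkIdeal 𝓕 (τ (j₂ y)) ⊔
        Ideal.span {(X.presheaf.Γgerm (τ (j₂ y))).hom ((σ ≫ q).appTop.hom ((Scheme.ΓSpecIso (.of O)).inv.hom ϖ))} = maximalIdeal _) ∧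
      (stalkIdeal C (τ (j₂ y)) ⊔ Ideal.span {(X.presheaf.Γgerm (τ (j₂ y))).hom ((σ ≫ q).appTop.hom ((Scheme.ΓSpecIso (.of O)).inv.hom ϖ))} ≠
        maximalIdeal _) ∧
      (stalkIdeal C (τ (j₂ y)) ⊔
        Ideal.span {(X.presheaf.Γgerm (τ (j₂ y))).hom ((σ ≫ q).appTop.hom ((Scheme.ΓSpecIso (.of O)).inv.hom ϖ))}).IsRadical ∧
      (∀ a, (X.presheaf.Γgerm (τ (j₂ y))).hom ((σ ≫ q).appTop.hom ((Scheme.ΓSpecIso (.of O)).inv.hom ϖ)) * a ∈ stalkIdeal C (τ (j₂ y)) →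
        a ∈ stalkIdeal C (τ (j₂ y))) := by
    rw [hpt]
    exact transversal_downstairs_package hsq hθ ϖ hϖ hC hCflat hF1 hT1 hT2 (υ₂ y) hy
  obtain ⟨h1, h2, h3, h4⟩ := hdown
  obtain ⟨wE, f', hExc, hSt, hrsop⟩ := exists_rsop_transversal_crossing hτ hE (j₂ y) hxC hxF _ h1 h2 h3 h4
  -- the uniformiser upstairs and the model square `j₂`
  set ϖB := (X₂.presheaf.Γgerm (j₂ y)).hom (((τ ≫ σ) ≫ q).appTop.hom ((Scheme.ΓSpecIso (.of O)).inv.hom ϖ)) with hϖB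
  have hϖB' : (τ.stalkMap (j₂ y)).hom ((X.presheaf.Γgerm (τ (j₂ y))).hom ((σ ≫ q).appTop.hom ((Scheme.ΓSpecIso (.of O)).inv.hom ϖ))) = ϖB := by
    rw [stalkMap_Γgerm_apply', hϖB, Scheme.Hom.comp_appTop, Scheme.Hom.comp_appTop, Scheme.Hom.comp_appTop]; rfl
  rw [hϖB'] at hrsop
  set ψ₂ := (j₂.stalkMap y).hom with hψ₂
  have hψ₂s : Function.Surjective ψ₂ := stalkMap_model_surjective θ hθ ((τ ≫ σ) ≫ q) j₂ t₂ hsq₂ y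
  have hψ₂ϖ : ψ₂ ϖB = 0 := stalkMap_model_varpi θ hθ ((τ ≫ σ) ≫ q) j₂ t₂ hsq₂ y ϖ (hϖ.maximalIdeal_eq ▸ Ideal.mem_span_singleton_self ϖ)
  have hker₂ : RingHom.ker ψ₂ = Ideal.span {ϖB} := by
    refine le_antisymm (ker_stalkMap_model_le O k θ hθ ((τ ≫ σ) ≫ q) j₂ t₂ hsq₂ y ϖ hϖ) ?_
    rw [Ideal.span_le, Set.singleton_subset_iff]; exact hψ₂ϖ
  -- the prime `𝔓 = (f', ϖ)` of `B = 𝒪_{X₂, j₂ y}`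
  haveI hBreg : IsRegularLocalRing (X₂.presheaf.stalk (j₂ y)) := hrsop.isRegularLocalRing
  have hsub : IsRsopPart (![wE, f', ϖB] ∘ Fin.succ) := hrsop.comp Fin.succ (Fin.succ_injective 2)
  have hrange : Set.range (![wE, f', ϖB] ∘ Fin.succ) = {f', ϖB} := by
    ext b
    simp only [Set.mem_range, Function.comp_apply, Set.mem_insert_iff, Set.mem_singleton_iff]
    constructor
    · rintro ⟨i, rfl⟩
      fin_cases i <;> simp
    · rintro (rfl | rfl)
      · exact ⟨0, by simp⟩
      · exact ⟨1, by simp⟩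
  have h𝔓prime : (Ideal.span {f', ϖB} : Ideal (X₂.presheaf.stalk (j₂ y))).IsPrime := by
    rw [← hrange]; exact hsub.isPrime_span_range
  have hwE : wE ∉ (Ideal.span {f', ϖB} : Ideal (X₂.presheaf.stalk (j₂ y))) := by
    have h := hrsop.not_mem_span_image (S := {1, 2}) (i := 0) (by decide)
    rwa [Set.image_insert_eq, Set.image_singleton] at h
  have hf'm : f' ∈ maximalIdeal (X₂.presheaf.stalk (j₂ y)) := hrsop.mem_maximalIdeal 1
  -- the stalk of `L` at `y`: `ψ₂ (f')`, i.e. the image of `𝔓`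
  have hLy : stalkIdeal ((strictTransformIdeal τ C 𝓕).comap j₂) y = (Ideal.span {f', ϖB}).map ψ₂ := by
    rw [stalkIdeal_comap_eq_map_stalkMap, hSt, ← hψ₂, Ideal.span_insert, Ideal.map_sup, Ideal.map_span _ {ϖB}, Set.image_singleton, hψ₂ϖ,
      Ideal.span_singleton_zero, sup_bot_eq]
  refine ⟨?_, ?_, ?_⟩
  · -- PRIME
    rw [hLy]
    exact Ideal.map_isPrime_of_surjective hψ₂s (by rw [hker₂]; exact Ideal.span_mono (Set.subset_insert _ _))
  · -- support
    rw [mem_support_iff_stalkIdeal_le, hLy, Ideal.map_le_iff_le_comap,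
      IsLocalRing.eq_maximalIdeal (Ideal.comap_isMaximal_of_surjective ψ₂ hψ₂s), Ideal.span_le]
    rintro b (rfl | rfl)
    · exact hf'm
    · exact hrsop.mem_maximalIdeal 2
  · -- closure: the generic point of `V(𝔓)` read in `X₂`, then in `G'`
    let fS := X₂.fromSpecStalk (j₂ y)
    have hfmem : ∀ (J : X₂.IdealSheafData) (𝔭 : PrimeSpectrum (X₂.presheaf.stalk (j₂ y))),
        fS 𝔭 ∈ J.support ↔ stalkIdeal J (j₂ y) ≤ 𝔭.asIdeal := by
      intro J 𝔭
      have h1 : fS 𝔭 ∈ J.support ↔ 𝔭 ∈ ((J.comap fS).support : Set (Spec (X₂.presheaf.stalk (j₂ y)))) := by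
        rw [Scheme.IdealSheafData.support_comap]; rfl
      rw [h1, comap_fromSpecStalk_eq_affineBlowupIdealSheaf, affineBlowup.support_idealSheaf]
      change ((stalkIdeal J (j₂ y) : Set (X₂.presheaf.stalk (j₂ y))) ⊆ (𝔭.asIdeal : Set (X₂.presheaf.stalk (j₂ y)))) ↔ _
      rw [SetLike.coe_subset_coe]
    -- the special-fibre ideal sheaf `𝓜 = 𝔪_O · 𝒪_{X₂}`: support = the special fibre, stalk = `(ϖB)`
    set r₂ := (τ ≫ σ) ≫ q with hr₂
    set 𝓜₀ : (Spec (.of O)).IdealSheafData := affineBlowup.idealSheaf (maximalIdeal O) with h𝓜₀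
    set 𝓜 : X₂.IdealSheafData := 𝓜₀.comap r₂ with h𝓜
    have h𝓜supp : ∀ z : X₂, z ∈ 𝓜.support ↔ r₂ z = closedPoint O := by
      intro z
      rw [h𝓜, Scheme.IdealSheafData.support_comap]
      change r₂ z ∈ (𝓜₀.support : Set (Spec (.of O))) ↔ _
      rw [h𝓜₀, affineBlowup.support_idealSheaf]
      change ((maximalIdeal O : Set O) ⊆ ((r₂ z).asIdeal : Set O)) ↔ _
      rw [SetLike.coe_subset_coe]
      constructor
      · intro h
        apply PrimeSpectrum.ext
        exact ((IsLocalRing.maximalIdeal.isMaximal O).eq_of_le (r₂ z).2.ne_top h).symm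
      · intro h; rw [h]; rfl
    have h𝓜stalk : stalkIdeal 𝓜 (j₂ y) = Ideal.span {ϖB} := by
      have h0 : stalkIdeal 𝓜₀ (r₂ (j₂ y)) =
          Ideal.span {((Spec (CommRingCat.of O)).presheaf.Γgerm (r₂ (j₂ y))).hom ((Scheme.ΓSpecIso (.of O)).inv.hom ϖ)} := by
        rw [stalkIdeal_eq_map_germ 𝓜₀ ⟨⊤, isAffineOpen_top _⟩ trivial, h𝓜₀, affineBlowup.idealSheaf, ideal_ofIdealTop_top,
          Ideal.map_map, hϖ.maximalIdeal_eq, Ideal.map_span, Set.image_singleton]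
        rfl
      rw [h𝓜, stalkIdeal_comap_eq_map_stalkMap, h0, Ideal.map_span, Set.image_singleton, stalkMap_Γgerm_apply']
    -- the point `η`
    set η : X₂ := fS ⟨Ideal.span {f', ϖB}, h𝔓prime⟩ with hη
    have hηsp : η ⤳ j₂ y := by
      have : η ∈ Set.range fS := ⟨_, rfl⟩
      rwa [Scheme.range_fromSpecStalk] at this
    have hηSt : η ∈ (strictTransformIdeal τ C 𝓕).support := by
      rw [hη, hfmem, hSt]; exact Ideal.span_mono (Set.singleton_subset_iff.mpr (Set.mem_insert _ _))
    have hηE : η ∉ (C.comap τ).support := by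
      rw [hη, hfmem, hExc, Ideal.span_singleton_le_iff_mem]; exact hwE
    have hηs : r₂ η = closedPoint O := by
      rw [← h𝓜supp, hη, hfmem, h𝓜stalk]
      exact Ideal.span_mono (by simp)
    -- `η = j₂ η'`
    have hηr : η ∈ Set.range j₂ := by
      rw [range_eq_preimage_of_isPullback hsq₂, range_specMap_of_surjective_of_field θ hθ]; exact hηs
    obtain ⟨η', hη'⟩ := hηr
    rw [← hη'] at hηsp hηSt hηE
    have hsp' : η' ⤳ y := (j₂.isClosedEmbedding.isInducing.specializes_iff).mp hηsp
    have hη'Z : υ₂ η' ∉ Z := by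
      intro hz
      apply hηE
      rw [Scheme.IdealSheafData.support_comap]
      change τ (j₂ η') ∈ (C.support : Set X)
      rw [← Scheme.Hom.comp_apply, hcomm, Scheme.Hom.comp_apply]
      exact (hZsupp _).mp hz
    have hη'L : η' ∈ ((strictTransformIdeal τ C 𝓕).comap j₂).support := by
      rw [Scheme.IdealSheafData.support_comap]; exact hηSt
    have hη'F : υ₂ η' ∈ F := (hmem_off η' hη'Z).mp hη'L
    have hmemη : η' ∈ υ₂ ⁻¹' (F \ Z) := ⟨hη'F, hη'Z⟩
    exact closure_mono (Set.singleton_subset_iff.mpr hmemη) (specializes_iff_mem_closure.mp hsp')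

/-- **T23-A′ (A′-3): the special-fibre trace of the strict transform of a transversal member is the downstairs strict transform, REDUCED.**
Statement = res-L1-w45b-stub-4's SIG v2 767f3543c2b2e4ae (hypotheses (T1)/(T2)); see the module docstring for the proof.
[cite: Liu2002, Thm. 8.1.19] [cite: Matsumura1987, Thm. 14.2] [cite: Kollar2007, Def. 3.25] [OURS · L1 W4.5b · T23-A′ (A′-3)] toward the B-residues
`stub_elnat_three_isolated_nonDefTowerB` / `stub_elnat_three_nonisolated_nonDefNoseTowerB` of stmt-ResolutionOfSingularities-20148 (widened
`TowerRoundB′`); NOT a statement of the manuscript. -/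
theorem comap_strictTransformIdeal_eq_vanishingIdeal_of_transversal [IsLocallyNoetherian X] [IsLocallyNoetherian X₂] [IsLocallyNoetherian G]
    [IsIntegral X] (_hXreg : Scheme.IsRegular X) (hsq : IsPullback jG tG (σ ≫ q) (Spec.map (CommRingCat.ofHom θ)))
    (hθ : Function.Surjective θ) [IsProper (σ ≫ q)]
    (hτ : IsBlowup τ C) (hυ₂ : IsBlowup υ₂ (vanishingIdeal ⟨Z, hZ⟩)) (hcomm : j₂ ≫ τ = υ₂ ≫ jG)
    (hsq₂ : IsPullback j₂ t₂ ((τ ≫ σ) ≫ q) (Spec.map (CommRingCat.ofHom θ)))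
    (hC : C.comap jG = vanishingIdeal ⟨Z, hZ⟩) (_hCreg : Scheme.IsRegular C.subscheme) (hCflat : Flat (C.subschemeι ≫ σ ≫ q))
    (hE : HasSNCWith [𝓕] C)
    (hF1 : 𝓕.comap jG = vanishingIdeal ⟨F, hF⟩) (_hF2 : ∀ z : X, (stalkIdeal 𝓕 z).IsPrincipal) (_hFflat : Flat (𝓕.subschemeι ≫ σ ≫ q))
    (hT1 : ∀ g ∈ Z ∩ F, stalkIdeal (vanishingIdeal (⟨Z, hZ⟩ : Closeds G)) g ⊔ stalkIdeal (vanishingIdeal (⟨F, hF⟩ : Closeds G)) g =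
      maximalIdeal (G.presheaf.stalk g))
    (hT2 : ∀ g ∈ Z ∩ F, stalkIdeal (vanishingIdeal (⟨Z, hZ⟩ : Closeds G)) g ≠ maximalIdeal (G.presheaf.stalk g)) :
    (strictTransformIdeal τ C 𝓕).comap j₂ = vanishingIdeal (⟨closure (υ₂ ⁻¹' (F \ Z)), isClosed_closure⟩ : Closeds G') := by
  classical
  haveI : IsClosedImmersion (Spec.map (CommRingCat.ofHom θ)) := IsClosedImmersion.spec_of_surjective _ hθ
  haveI : IsClosedImmersion jG := MorphismProperty.IsStableUnderBaseChange.of_isPullback hsq.flip inferInstance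
  haveI : IsClosedImmersion j₂ := MorphismProperty.IsStableUnderBaseChange.of_isPullback hsq₂.flip inferInstance
  set L := (strictTransformIdeal τ C 𝓕).comap j₂ with hL
  have hpt : ∀ y : G', τ (j₂ y) = jG (υ₂ y) := fun y => by rw [← Scheme.Hom.comp_apply, hcomm, Scheme.Hom.comp_apply]
  have hZsupp : ∀ g : G, g ∈ Z ↔ jG g ∈ C.support := fun g => by
    have h : g ∈ ((C.comap jG).support : Set G) ↔ jG g ∈ C.support := by
      rw [Scheme.IdealSheafData.support_comap]; rfl
    rw [← h, hC, Scheme.IdealSheafData.coe_support_vanishingIdeal]; rfl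
  have hFsupp : ∀ g : G, g ∈ F ↔ jG g ∈ 𝓕.support := fun g => by
    have h : g ∈ ((𝓕.comap jG).support : Set G) ↔ jG g ∈ 𝓕.support := by
      rw [Scheme.IdealSheafData.support_comap]; rfl
    rw [← h, hF1, Scheme.IdealSheafData.coe_support_vanishingIdeal]; rfl
  -- OFF `Z`: `L_y = υ₂♯ 𝓘⟨F⟩_g`
  have hLoff : ∀ y : G', υ₂ y ∉ Z → stalkIdeal L y = stalkIdeal ((vanishingIdeal (⟨F, hF⟩ : Closeds G)).comap υ₂) y := by
    intro y hy
    have hx : τ (j₂ y) ∉ C.support := by rw [hpt]; exact fun h => hy ((hZsupp _).mpr h)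
    rw [hL, stalkIdeal_comap_eq_map_stalkMap, stalkIdeal_strictTransformIdeal_of_not_mem_support (π := τ) C 𝓕 hx,
      ← stalkIdeal_comap_eq_map_stalkMap τ 𝓕, ← stalkIdeal_comap_eq_map_stalkMap j₂ (𝓕.comap τ),
      ← Scheme.IdealSheafData.comap_comp, hcomm, Scheme.IdealSheafData.comap_comp, hF1]
  have hmem_off : ∀ y : G', υ₂ y ∉ Z → (y ∈ L.support ↔ υ₂ y ∈ F) := by
    intro y hy
    rw [mem_support_iff_stalkIdeal_le, hLoff y hy, ← mem_support_iff_stalkIdeal_le, Scheme.IdealSheafData.support_comap]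
    change υ₂ y ∈ ((vanishingIdeal (⟨F, hF⟩ : Closeds G)).support : Set G) ↔ _
    rw [Scheme.IdealSheafData.coe_support_vanishingIdeal]; rfl
  have hrad_off : ∀ y : G', υ₂ y ∉ Z → (stalkIdeal L y).IsRadical := by
    intro y hy
    rw [hLoff y hy, stalkIdeal_comap_eq_map_stalkMap]
    have hyZ : υ₂ y ∉ (vanishingIdeal (⟨Z, hZ⟩ : Closeds G)).support := by
      change υ₂ y ∉ ((vanishingIdeal (⟨Z, hZ⟩ : Closeds G)).support : Set G)
      rw [Scheme.IdealSheafData.coe_support_vanishingIdeal]; exact hy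
    haveI := hυ₂.isIso_stalkMap_of_not_mem_support hyZ
    haveI := ComponentGluing.isReduced_subscheme_vanishingIdeal (⟨F, hF⟩ : Closeds G)
    exact isRadical_map_of_bijective _ (ConcreteCategory.bijective_of_isIso (υ₂.stalkMap y))
      (isRadical_stalkIdeal_of_isReduced_subscheme (vanishingIdeal (⟨F, hF⟩ : Closeds G)) (υ₂ y))
  -- OVER `Z` but off `F`: `L_y = ⊤`
  have hnot : ∀ y : G', υ₂ y ∈ Z → υ₂ y ∉ F → y ∉ L.support := by
    intro y _ hyF hyL
    apply hyF
    rw [hFsupp, ← hpt]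
    have h1 : j₂ y ∈ (strictTransformIdeal τ C 𝓕).support := by
      rw [hL, Scheme.IdealSheafData.support_comap] at hyL; exact hyL
    have h2 : j₂ y ∈ (𝓕.comap τ).support :=
      Scheme.IdealSheafData.support_antitone
        ((comap_le_controlledTransform τ C 𝓕 0).trans (controlledTransform_le_strictTransformIdeal τ C 𝓕 0)) h1
    rw [Scheme.IdealSheafData.support_comap] at h2; exact h2
  -- (I) `L` is radical
  have hrad : L.radical = L := by
    rw [radical_eq_iff_forall_stalkIdeal]
    intro y
    by_cases hyZ : υ₂ y ∈ Z
    · by_cases hyF : υ₂ y ∈ F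
      · exact (transversal_crossing_package hsq hθ hτ hcomm hsq₂ hC hCflat hE hF1 hT1 hT2 hmem_off y ⟨hyZ, hyF⟩).1.isRadical
      · rw [stalkIdeal_eq_top_of_not_mem_support (hnot y hyZ hyF)]
        exact fun _ _ => Submodule.mem_top
    · exact hrad_off y hyZ
  -- (II) the support of `L`
  have hsupp : (L.support : Set G') = closure (υ₂ ⁻¹' (F \ Z)) := by
    apply le_antisymm
    · intro y hyL
      by_cases hyZ : υ₂ y ∈ Z
      · by_cases hyF : υ₂ y ∈ F
        · exact (transversal_crossing_package hsq hθ hτ hcomm hsq₂ hC hCflat hE hF1 hT1 hT2 hmem_off y ⟨hyZ, hyF⟩).2.2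
        · exact absurd hyL (hnot y hyZ hyF)
      · exact subset_closure ⟨(hmem_off y hyZ).mp hyL, hyZ⟩
    · exact closure_minimal (fun y hy => (hmem_off y hy.2).mpr hy.1) L.support.isClosed
  -- (III) radical + support
  rw [← hrad, ← vanishingIdeal_support]
  congr 1
  exact TopologicalSpace.Closeds.ext hsupp

end Trace

end Summit.ResolutionOfSingularities.ResolutionOfSingularities.Cruxes.EquisingularLiftNat.Sections

end
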